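import Literature.AlgebraicGeometry.Motives.TopFormCocycleUnitAt
import HarnessLib

/-!
# The Jacobian cocycle of a rational top form along a PAIR of morphisms inducing isomorphisms of
# local rings is a unit at the point

Topic `Literature/AlgebraicGeometry/Motives` (proofs only; no definitions, no named facts).  Generalises
★ `isUnitAt_cocycle_of_isIso_stalkMap` (an ENDOMORPHISM `Φ : Y → Y`) to a pair of dominant morphisms
`Φ, ι : Y' → Y` of integral schemes which both induce isomorphisms of local rings at `q ∈ Y'` over a base
ring `A` — the shape in which the (W0) core of the cell hodgecm-mathlib's road W meets it: `Y' = D` an open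
of `Y = 𝒳 ×_R 𝒳` (`ι` its inclusion) and `Φ = (pr₁, m) : D → Y` the shear map of a birational group law,
which is NOT an endomorphism of `Y`.  If the rational top form `θ = (f, u)` on `Y` (relative to `A`,
`d uᵢ` the basis `B` of `Ω[K(Y)⁄A]`) is a frame at `ι q` and at `Φ q`, then the cocycle
`Φ♯ f · C.det (d Φ♯ uᵢ)ᵢ · (ι♯ f)⁻¹ ∈ K(Y')` — the ratio `Φ^*θ / ι^*θ`, `C` the basis `d (ι♯ uᵢ)` of
`Ω[K(Y')⁄A]` — is a unit at `q`: it equals `Φ♯(f · W'.det B) · W.det W'' · (ι♯ (f · W₁.det B))⁻¹` with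
`W`, `W''` the function-field bases of the coordinates at `q` transported from `ι q` and from `Φ q`
(★ `exists_localCoordinates_of_isIso_stalkMap`), a product of three units.  The proof is ★'s, verbatim up to
the second transport.  [cite: BLRNeronModels1990, §4.3 (Prop. 2, proof)] [cite: EdixhovenRomagny2012, Thm. 6.3 (proof)]

## Sources
* S. Bosch, W. Lütkebohmert, M. Raynaud, *Néron Models*, Springer 1990, §4.3 (proof of Prop. 2).
* B. Edixhoven, M. Romagny, *Group schemes out of birational group laws, Néron models*, arXiv:1204.1799v2,
  proof of Thm. 6.3.
* Tree: `Motives/TopFormCocycleUnitAt.lean` (`isUnitAt_cocycle_of_isIso_stalkMap`, `det_D_ringHom_eq`),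
  `Motives/RelativeLocalCoordinates.lean` (`exists_localCoordinates_of_isIso_stalkMap`,
  `exists_basis_functionField_of_localCoordinates'`, `isUnitAt_det_of_localCoordinates'`).
-/

noncomputable section

universe u

open CategoryTheory AlgebraicGeometry Opposite

namespace Literature.AlgebraicGeometry.Motives

open RatFn Literature.RingTheory.Derivation

variable {Y' Y : Scheme.{u}} [IsIntegral Y'] [IsIntegral Y] (Φ ι : Y' ⟶ Y) [IsDominant Φ] [IsDominant ι]
  (n : ℕ) (A : Type u) [CommRing A] (q : Y')
  [Algebra A (Y'.presheaf.stalk q)] [Algebra A (Y.presheaf.stalk (Φ.base q))]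
  [Algebra A (Y.presheaf.stalk (ι.base q))]
  [Algebra A Y.functionField] [Algebra A Y'.functionField]
  [IsScalarTower A (Y'.presheaf.stalk q) Y'.functionField]

/-- **The cocycle `Φ^*θ / ι^*θ` in three factors** (pure function-field algebra, the identity behind
`isUnitAt_cocycle_of_isIso_stalkMap_pair`; exposed so that consumers can compute GERMS and residues of the
cocycle factor by factor).  For `σ := Φ♯`, `τ := ι♯ : K(Y) → K(Y')` over `A`, a top form `(f, u)` on `Y`
with `d uᵢ = B`, `C` the basis `d (τ uᵢ)` of `Ω[K(Y')⁄A]`, and ANY two coordinate families `v₁`, `v'` on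
`Y` (function-field bases `W₁ = d v₁`, `W' = d v'` over `A`) with transported bases `W = d (τ v₁)`,
`W'' = d (σ v')` on `Y'`:
`σ f · C.det (d σ uᵢ) · (τ f)⁻¹ = σ (f · W'.det B) · W.det W'' · (τ (f · W₁.det B))⁻¹`.
[cite: BLRNeronModels1990, §4.3 (Prop. 2, proof)] -/
theorem cocycle_eq_three_factors
    (hΦA : (functionFieldMap Φ).comp (algebraMap A Y.functionField) = algebraMap A Y'.functionField)
    (hιA : (functionFieldMap ι).comp (algebraMap A Y.functionField) = algebraMap A Y'.functionField)
    {v₁ : Fin n → Y.functionField} (W₁ : Module.Basis (Fin n) Y.functionField Ω[Y.functionField⁄A])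
    (hW₁ : ∀ i, W₁ i = KaehlerDifferential.D A _ (v₁ i))
    (W : Module.Basis (Fin n) Y'.functionField Ω[Y'.functionField⁄A])
    (hW : ∀ i, W i = KaehlerDifferential.D A _ (functionFieldMap ι (v₁ i)))
    {v' : Fin n → Y.functionField} (W' : Module.Basis (Fin n) Y.functionField Ω[Y.functionField⁄A])
    (hW' : ∀ i, W' i = KaehlerDifferential.D A _ (v' i))
    (W'' : Module.Basis (Fin n) Y'.functionField Ω[Y'.functionField⁄A])
    (hW'' : ∀ i, W'' i = KaehlerDifferential.D A _ (functionFieldMap Φ (v' i)))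
    (f : Y.functionField) {u : Fin n → Y.functionField}
    (B : Module.Basis (Fin n) Y.functionField Ω[Y.functionField⁄A])
    (hB : ∀ i, B i = KaehlerDifferential.D A _ (u i))
    (C : Module.Basis (Fin n) Y'.functionField Ω[Y'.functionField⁄A])
    (hC : ∀ i, C i = KaehlerDifferential.D A _ (functionFieldMap ι (u i))) :
    functionFieldMap Φ f *
        C.det (fun i => KaehlerDifferential.D A _ (functionFieldMap Φ (u i))) *
          (functionFieldMap ι f)⁻¹ =
      functionFieldMap Φ (f * W'.det B) * W.det W'' * (functionFieldMap ι (f * W₁.det B))⁻¹ := by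
  classical
  set σ := functionFieldMap Φ with hσ
  set τ := functionFieldMap ι with hτ
  -- chain rules along `σ` and `τ`
  have hchain : ∀ v : Fin n → Y.functionField,
      W''.det (fun j => KaehlerDifferential.D A _ (σ (v j))) =
        σ (W'.det fun j => KaehlerDifferential.D A _ (v j)) := fun v =>
    det_D_ringHom_eq (RingHom.id A) σ (by rw [hΦA, RingHom.comp_id]) W' hW' W'' hW'' v
  have hchain₁ : ∀ v : Fin n → Y.functionField,
      W.det (fun j => KaehlerDifferential.D A _ (τ (v j))) =
        τ (W₁.det fun j => KaehlerDifferential.D A _ (v j)) := fun v =>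
    det_D_ringHom_eq (RingHom.id A) τ (by rw [hιA, RingHom.comp_id]) W₁ hW₁ W hW v
  have hCσ : C.det (fun i => KaehlerDifferential.D A _ (σ (u i))) =
      C.det W'' * W''.det (fun i => KaehlerDifferential.D A _ (σ (u i))) := by
    rw [Module.Basis.det_apply, Module.Basis.det_apply, Module.Basis.det_apply, ← Matrix.det_mul,
      Module.Basis.toMatrix_mul_toMatrix]
  have huB : (fun j => KaehlerDifferential.D A Y.functionField (u j)) = ⇑B := funext fun j => (hB j).symm
  have hdet1 : W''.det (fun i => KaehlerDifferential.D A _ (σ (u i))) = σ (W'.det B) := by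
    rw [hchain u, huB]
  have hCW'' : C.det W'' = C.det W * W.det W'' := by
    rw [Module.Basis.det_apply, Module.Basis.det_apply, Module.Basis.det_apply, ← Matrix.det_mul,
      Module.Basis.toMatrix_mul_toMatrix]
  have hWC : W.det C * C.det W = 1 := by
    rw [Module.Basis.det_apply, Module.Basis.det_apply, ← Matrix.det_mul,
      Module.Basis.toMatrix_mul_toMatrix, Module.Basis.toMatrix_self, Matrix.det_one]
  have hCdef : (⇑C) = fun i => KaehlerDifferential.D A Y'.functionField (τ (u i)) := funext hC
  have hdetC : W.det C = τ (W₁.det B) := by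
    rw [hCdef, hchain₁ u, huB]
  rw [hCσ, hdet1, hCW'', map_mul, map_mul, mul_inv]
  have hCW : C.det W = (τ (W₁.det B))⁻¹ := by
    rw [← hdetC]; exact eq_inv_of_mul_eq_one_right hWC
  rw [hCW]
  ring

/-- **The Jacobian cocycle `Φ^*θ / ι^*θ` of a top form that is a frame at `ι q` and at `Φ q` is a unit at
`q`**, for two dominant morphisms `Φ ι : Y' ⟶ Y` of integral schemes inducing isomorphisms
`𝒪_{Y,Φ q} ≅ 𝒪_{Y',q}`, `𝒪_{Y,ι q} ≅ 𝒪_{Y',q}` over `A` (hypotheses `hAΦ`, `hAι`; on function fields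
`hΦA`, `hιA`).  Data: relative coordinates `w₁` at `ι q` (stalk basis `b₁`, function-field basis `W₁`) and
`w'` at `Φ q` (`b'`, `W'`); a rational top form `(f, u)` on `Y` relative to `A` with `d uᵢ` the basis `B`
of `Ω[K(Y)⁄A]`, a frame at `ι q` and at `Φ q`; `C` the basis `d (ι♯ uᵢ)` of `Ω[K(Y')⁄A]`.  Conclusion:
`Φ♯ f · C.det (d (Φ♯ uᵢ))ᵢ · (ι♯ f)⁻¹` is a unit at `q`: by `cocycle_eq_three_factors` with the coordinates
transported to `q` (★ `exists_localCoordinates_of_isIso_stalkMap`) it is `Φ♯(f · W'.det B) · W.det W'' ·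
(ι♯ (f · W₁.det B))⁻¹`, a product of three units at `q`.  ★ `isUnitAt_cocycle_of_isIso_stalkMap` is the
case `Y' = Y`, `ι = 𝟙`. [cite: BLRNeronModels1990, §4.3 (Prop. 2, proof)] [cite: EdixhovenRomagny2012, Thm. 6.3 (proof)] -/
theorem isUnitAt_cocycle_of_isIso_stalkMap_pair [IsIso (Φ.stalkMap q)] [IsIso (ι.stalkMap q)]
    (hAΦ : (Φ.stalkMap q).hom.comp (algebraMap A (Y.presheaf.stalk (Φ.base q))) =
      algebraMap A (Y'.presheaf.stalk q))
    (hAι : (ι.stalkMap q).hom.comp (algebraMap A (Y.presheaf.stalk (ι.base q))) =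
      algebraMap A (Y'.presheaf.stalk q))
    (hΦA : (functionFieldMap Φ).comp (algebraMap A Y.functionField) = algebraMap A Y'.functionField)
    (hιA : (functionFieldMap ι).comp (algebraMap A Y.functionField) = algebraMap A Y'.functionField)
    -- relative coordinates at `ι q`
    {w₁ : Fin n → Y.presheaf.stalk (ι.base q)}
    (b₁ : Module.Basis (Fin n) (Y.presheaf.stalk (ι.base q)) Ω[Y.presheaf.stalk (ι.base q)⁄A])
    (hb₁ : ∀ i, b₁ i = KaehlerDifferential.D A _ (w₁ i))
    (W₁ : Module.Basis (Fin n) Y.functionField Ω[Y.functionField⁄A])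
    (hW₁ : ∀ i, W₁ i = KaehlerDifferential.D A _ (toFunctionField (ι.base q) (w₁ i)))
    -- relative coordinates at `Φ q`
    {w' : Fin n → Y.presheaf.stalk (Φ.base q)}
    (b' : Module.Basis (Fin n) (Y.presheaf.stalk (Φ.base q)) Ω[Y.presheaf.stalk (Φ.base q)⁄A])
    (hb' : ∀ i, b' i = KaehlerDifferential.D A _ (w' i))
    (W' : Module.Basis (Fin n) Y.functionField Ω[Y.functionField⁄A])
    (hW' : ∀ i, W' i = KaehlerDifferential.D A _ (toFunctionField (Φ.base q) (w' i)))
    -- the top form `(f, u)` on `Y`, its frame hypotheses, and the basis `C = d (ι♯ u)` on `Y'`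
    (f : Y.functionField) {u : Fin n → Y.functionField}
    (B : Module.Basis (Fin n) Y.functionField Ω[Y.functionField⁄A])
    (hB : ∀ i, B i = KaehlerDifferential.D A _ (u i))
    (hq₁ : IsUnitAt (ι.base q) (f * W₁.det B)) (hq' : IsUnitAt (Φ.base q) (f * W'.det B))
    (C : Module.Basis (Fin n) Y'.functionField Ω[Y'.functionField⁄A])
    (hC : ∀ i, C i = KaehlerDifferential.D A _ (functionFieldMap ι (u i))) :
    IsUnitAt q (functionFieldMap Φ f *
      C.det (fun i => KaehlerDifferential.D A _ (functionFieldMap Φ (u i))) *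
        (functionFieldMap ι f)⁻¹) := by
  classical
  -- (1) transport both coordinate systems to `q`
  obtain ⟨b'', hb'', hff⟩ := exists_localCoordinates_of_isIso_stalkMap Φ n A q hAΦ b' hb'
  obtain ⟨W'', hW''⟩ := exists_basis_functionField_of_localCoordinates' n A b'' hb''
  have hW''σ : ∀ i, W'' i =
      KaehlerDifferential.D A _ (functionFieldMap Φ (toFunctionField (Φ.base q) (w' i))) :=
    fun i => by rw [hW'', hff]
  obtain ⟨b₁'', hb₁'', hff₁⟩ := exists_localCoordinates_of_isIso_stalkMap ι n A q hAι b₁ hb₁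
  obtain ⟨W, hW⟩ := exists_basis_functionField_of_localCoordinates' n A b₁'' hb₁''
  have hWτ : ∀ i, W i =
      KaehlerDifferential.D A _ (functionFieldMap ι (toFunctionField (ι.base q) (w₁ i))) :=
    fun i => by rw [hW, hff₁]
  -- (2) the three-factor identity and the three units at `q`
  rw [cocycle_eq_three_factors Φ ι n A hΦA hιA W₁ hW₁ W hWτ W' hW' W'' hW''σ f B hB C hC]
  have hu1 : IsUnitAt q (functionFieldMap Φ (f * W'.det B)) := hq'.functionFieldMap
  have hu2 : IsUnitAt q (W.det W'') :=
    (isUnitAt_det_of_localCoordinates' n A b'' hb'' b₁'' hb₁'' hW'' hW).2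
  have hu3 : IsUnitAt q (functionFieldMap ι (f * W₁.det B))⁻¹ := (hq₁.functionFieldMap).inv
  exact (hu1.mul hu2).mul hu3

/-- **The cocycle as the rational function of an explicit GERM at `q`** (three-factor form at the level of
stalks, for residue computations by consumers): in the setting of `isUnitAt_cocycle_of_isIso_stalkMap_pair`,
with `bq` the basis `d (ι♯_q w₁ᵢ)` of `Ω[𝒪_{Y',q}⁄A]` transported from `ι q`, and unit germs `t'` at `Φ q`,
`t₁` at `ι q` of the frame functions `f · W'.det B`, `f · W₁.det B`, the cocycle `Φ♯ f · C.det (d Φ♯ uᵢ) · (ι♯ f)⁻¹`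
is the rational function of the germ `Φ♯_q(t') · bq.det (d (Φ♯_q w'ᵢ))ᵢ · (ι♯_q t₁)⁻¹ ∈ 𝒪_{Y',q}` — the middle
factor being the relative Jacobian germ of `Φ` in the `ι`-transported coordinates.
[cite: BLRNeronModels1990, §4.3 (Prop. 2, proof)] -/
theorem exists_germs_cocycle_eq [IsIso (Φ.stalkMap q)] [IsIso (ι.stalkMap q)]
    (hAΦ : (Φ.stalkMap q).hom.comp (algebraMap A (Y.presheaf.stalk (Φ.base q))) =
      algebraMap A (Y'.presheaf.stalk q))
    (hAι : (ι.stalkMap q).hom.comp (algebraMap A (Y.presheaf.stalk (ι.base q))) =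
      algebraMap A (Y'.presheaf.stalk q))
    (hΦA : (functionFieldMap Φ).comp (algebraMap A Y.functionField) = algebraMap A Y'.functionField)
    (hιA : (functionFieldMap ι).comp (algebraMap A Y.functionField) = algebraMap A Y'.functionField)
    -- relative coordinates at `ι q`
    {w₁ : Fin n → Y.presheaf.stalk (ι.base q)}
    (b₁ : Module.Basis (Fin n) (Y.presheaf.stalk (ι.base q)) Ω[Y.presheaf.stalk (ι.base q)⁄A])
    (hb₁ : ∀ i, b₁ i = KaehlerDifferential.D A _ (w₁ i))
    (W₁ : Module.Basis (Fin n) Y.functionField Ω[Y.functionField⁄A])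
    (hW₁ : ∀ i, W₁ i = KaehlerDifferential.D A _ (toFunctionField (ι.base q) (w₁ i)))
    -- relative coordinates at `Φ q`
    {w' : Fin n → Y.presheaf.stalk (Φ.base q)}
    (b' : Module.Basis (Fin n) (Y.presheaf.stalk (Φ.base q)) Ω[Y.presheaf.stalk (Φ.base q)⁄A])
    (hb' : ∀ i, b' i = KaehlerDifferential.D A _ (w' i))
    (W' : Module.Basis (Fin n) Y.functionField Ω[Y.functionField⁄A])
    (hW' : ∀ i, W' i = KaehlerDifferential.D A _ (toFunctionField (Φ.base q) (w' i)))
    -- the top form `(f, u)` on `Y`, its frame hypotheses, and the basis `C = d (ι♯ u)` on `Y'`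
    (f : Y.functionField) {u : Fin n → Y.functionField}
    (B : Module.Basis (Fin n) Y.functionField Ω[Y.functionField⁄A])
    (hB : ∀ i, B i = KaehlerDifferential.D A _ (u i))
    (hq₁ : IsUnitAt (ι.base q) (f * W₁.det B)) (hq' : IsUnitAt (Φ.base q) (f * W'.det B))
    (C : Module.Basis (Fin n) Y'.functionField Ω[Y'.functionField⁄A])
    (hC : ∀ i, C i = KaehlerDifferential.D A _ (functionFieldMap ι (u i))) :
    ∃ (bq : Module.Basis (Fin n) (Y'.presheaf.stalk q) Ω[Y'.presheaf.stalk q⁄A])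
      (_ : ∀ i, bq i = KaehlerDifferential.D A _ (ι.stalkMap q (w₁ i)))
      (t' : (Y.presheaf.stalk (Φ.base q))ˣ) (_ : toFunctionField (Φ.base q) (t' : Y.presheaf.stalk _) =
        f * W'.det B)
      (t₁ : (Y.presheaf.stalk (ι.base q))ˣ) (_ : toFunctionField (ι.base q) (t₁ : Y.presheaf.stalk _) =
        f * W₁.det B),
      toFunctionField q (Φ.stalkMap q t' *
          bq.det (fun i => KaehlerDifferential.D A _ (Φ.stalkMap q (w' i))) *
          ((Units.map (ι.stalkMap q).hom.toMonoidHom t₁)⁻¹ : (Y'.presheaf.stalk q)ˣ)) =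
        functionFieldMap Φ f *
          C.det (fun i => KaehlerDifferential.D A _ (functionFieldMap Φ (u i))) *
            (functionFieldMap ι f)⁻¹ := by
  classical
  -- transport both coordinate systems to `q`
  obtain ⟨b'', hb'', hff⟩ := exists_localCoordinates_of_isIso_stalkMap Φ n A q hAΦ b' hb'
  obtain ⟨W'', hW''⟩ := exists_basis_functionField_of_localCoordinates' n A b'' hb''
  have hW''σ : ∀ i, W'' i =
      KaehlerDifferential.D A _ (functionFieldMap Φ (toFunctionField (Φ.base q) (w' i))) :=
    fun i => by rw [hW'', hff]
  obtain ⟨bq, hbq, hff₁⟩ := exists_localCoordinates_of_isIso_stalkMap ι n A q hAι b₁ hb₁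
  obtain ⟨W, hW⟩ := exists_basis_functionField_of_localCoordinates' n A bq hbq
  have hWτ : ∀ i, W i =
      KaehlerDifferential.D A _ (functionFieldMap ι (toFunctionField (ι.base q) (w₁ i))) :=
    fun i => by rw [hW, hff₁]
  -- the unit germs of the two frame functions
  obtain ⟨t', ht'⟩ := hq'
  obtain ⟨t₁, ht₁⟩ := hq₁
  refine ⟨bq, hbq, t', ht', t₁, ht₁, ?_⟩
  -- the three-factor form on function fields
  rw [cocycle_eq_three_factors Φ ι n A hΦA hιA W₁ hW₁ W hWτ W' hW' W'' hW''σ f B hB C hC]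
  -- and factor by factor on germs
  have hmid : (W.det W'' : Y'.functionField) = toFunctionField q (bq.det b'') :=
    (isUnitAt_det_of_localCoordinates' n A b'' hb'' bq hbq hW'' hW).1
  have hb''fun : (fun i => KaehlerDifferential.D A (Y'.presheaf.stalk q) (Φ.stalkMap q (w' i))) = ⇑b'' :=
    funext fun i => (hb'' i).symm
  have h1 : toFunctionField q (Φ.stalkMap q (t' : Y.presheaf.stalk _)) =
      functionFieldMap Φ (f * W'.det B) := by
    rw [← ht', functionFieldMap_toFunctionField]
  have h3 : toFunctionField q (ι.stalkMap q (t₁ : Y.presheaf.stalk _)) =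
      functionFieldMap ι (f * W₁.det B) := by
    rw [← ht₁, functionFieldMap_toFunctionField]
  rw [map_mul, map_mul, hb''fun, ← hmid, h1]
  congr 1
  rw [← h3, map_units_inv, Units.coe_map]
  rfl

end Literature.AlgebraicGeometry.Motives

end
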